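import Summits.QuantumFields.BalabanUV.Beta.EriceRemainderEnclosureHistoryAutonomyComparisonGreedyDualChain

/-!
# EriceRemainderEnclosureHistoryAutonomyComparisonGreedyNearChain — (E69a) THE GREEDY CERTIFICATE UNDER THE DUAL CHAIN WITH THE NEAREST-NEIGHBOUR-EXACT
# DEFECT: as (E65e), but the far-field transport reads the NEAREST younger age's defect coefficient EXACTLY — `1 − (k∕(k+k⁻))²` instead of `2k⁻∕k`
# (a factor `1.52` at ratio 3, `1.8` at ratio 2) — and only the older ones by `2s∕k`: `e_k = min(a_kμ_{k⁻}, 2λ_{k⁻}r_k − (2r_k − δ_k)·σ₀(x_{k⁻}))`, `δ_k = 1 −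
# (k∕(k+k⁻))²`, `σ₀(x) = x∕(1 − 3x∕4)` (the certified lower bound `c_{k⁻} ≥ σ₀(x_{k⁻})·D` of the last consumption — a SIXTH invariant of the induction).
# Extra hypotheses: `3x_k∕4 < 1` and `λ_k(1 − 3x_k∕4) ≥ x_k` on `A` (true for every natural chain value).  Why: the two-step closure of the defect invariant
# `e ≤ 2u∕(1 − u)` on towers of ratio 3 under the refined line (E67f) has margin 0.001 at the earliest generic step with (E65e)'s transport and 0.040 with
# this one (README g59, `r3twostep4.py`) — the criterion half of the ratio-3 station

Cell `pub-balaban`, β-function sub-cell, BINDER row D4 «RemainderConst leaves for Bałaban's split» (`HOME/BINDER-OWNERS.md`; owner lineage `b2b-balaban-beta-an4`;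
this file by co-owner #2 lineage `b2b-balaban-beta-d4-p2`, generation 59), β-FLOW TEAM duty (1), FREEZE (0) honoured (def-free; Mathlib + (E65c)'s
`defect_ratio_le`, (E65e)'s `defect_le_two_mul_div` BY NAME).

HONEST FRAMING (page 1, verbatim and binding).  *"Discharging BetaPertH makes Bałaban's UV stability UNCONDITIONAL — a real constructive-QFT result; it is
NOT the continuum limit and NOT the Clay problem."*  THIS FILE DISCHARGES NOTHING OF THE KIND.  A lemma about finitely many non-negative reals; its use is
through (E65b), whose hypotheses are those of a census, not facts; nothing of Bałaban's is asserted.  Row D4 class UNCHANGED (critical-path width 0; instance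
0∕1; D4 DISCHARGE NO DATE).  HONEST DEPENDENCY: continuum YM on T⁴ ⇐ BetaPertH ∧ nine spine estimates (0/9 proved); BetaPertH ⇐ (D1) ∧ (D4) ∧ CAP+tail;
G-an2-4 gates asym, D1 and NE2/3/4.

THE POINT (census sense (α); the COMPARISON column, conjecture (E58′), route (C″-3)).  `E_k = Σ_{s<k}(1 − (k∕(k+s))²)c_s = δ_k·c_{k⁻} + Σ_{s<k⁻}(…)c_s ≤
δ_k c_{k⁻} + (2∕k)(Φ_{≤k⁻} − k⁻c_{k⁻})`, and the greedy consumption satisfies `c_{k⁻} ≥ x_{k⁻}D_{k⁻}∕(1 + x∕4) ≥ σ₀(x_{k⁻})·D` (`D` after `k⁻`), so with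
`Φ ≤ λk⁻D`: `E_k ≤ [2λ_{k⁻}r − (2r − δ)σ₀(x_{k⁻})]·D`.  NOT CLAIMED: the ratio-3 chain itself (OPEN, README); anything printed.

WHAT IS PROVED ([folklore]; 0 `def`, 0 sorry).  **`certificate_of_near_chain`**.
-/
noncomputable section
open Finset

namespace Summit.QuantumFields.BalabanUV.Beta.EriceRemainderEnclosureHistoryAutonomyComparisonGreedyNearChain

open Summit.QuantumFields.BalabanUV.Beta.EriceRemainderEnclosureHistoryAutonomyComparisonGreedyChain (defect_ratio_le)
open Summit.QuantumFields.BalabanUV.Beta.EriceRemainderEnclosureHistoryAutonomyComparisonGreedyDualChain (defect_le_two_mul_div)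

/-! ## The greedy certificate under the near chain -/

set_option maxHeartbeats 800000 in
/-- **THE GREEDY CERTIFICATE UNDER THE NEAR CHAIN.**  `A` a finite set of ages `≥ 1` with minimum `m₀` and predecessor map `pred`; loads `0 ≤ x < 4∕3`;
chain values `μ, λ ≥ 0` on `A` with `λ_k(1 − 3x_k∕4) ≥ x_k`; write `a_k = 4·pred k·k∕(k + pred k)²`, `r_k = pred k∕k`, `δ_k = 1 − (k∕(k + pred k))²`,
`σ_k = x_{pred k}∕(1 − 3x_{pred k}∕4)` and **`e_k = min(a_kμ_{pred k}, 2λ_{pred k}r_k − (2r_k − δ_k)σ_k)`**.  Suppose `μ_{m₀}(1 − 3x_{m₀}∕4) ≥ 3x_{m₀}∕4` and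
for every `k ≠ m₀` in `A`: `x_k(e_k + 3∕4) < 1`, `μ_k(1 − x_k(3∕4 + e_k)) ≥ e_k(1 + x_k) + 3x_k∕4`, `λ_k(1 − x_k(3∕4 + e_k)) ≥ λ_{pred k}r_k(1 + x_k∕4) +
x_k(1 + e_k)`.  Then there is `π ≥ 0` on `A` with `π_{k′} + Σ_{j∈A} x_j(k′∕(k′+j))²π_j ≥ 1` (`k′ ∈ A`) and `Σ_{j∈A} x_jπ_j ≤ 1` — a certificate for
(E64e)∕(E65b).  (E65e)'s induction with a sixth invariant `x_{max}·D ≤ c_{max}(1 − 3x_{max}∕4)`. [folklore] -/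
theorem certificate_of_near_chain {A : Finset ℕ} {x μ lam : ℕ → ℝ} {pred : ℕ → ℕ} {m₀ : ℕ}
    (hA1 : ∀ k ∈ A, 1 ≤ k) (hx : ∀ k ∈ A, 0 ≤ x k) (hm₀ : m₀ ∈ A) (hmin : ∀ k ∈ A, m₀ ≤ k)
    (hpred : ∀ k ∈ A, k ≠ m₀ → pred k ∈ A ∧ pred k < k ∧ ∀ k'' ∈ A, k'' < k → k'' ≤ pred k)
    (hμ : ∀ k ∈ A, 0 ≤ μ k) (hlam : ∀ k ∈ A, 0 ≤ lam k) (hx34 : ∀ k ∈ A, 3 / 4 * x k < 1)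
    (hμ₀ : 3 / 4 * x m₀ ≤ μ m₀ * (1 - 3 / 4 * x m₀)) (hlamx : ∀ k ∈ A, x k ≤ lam k * (1 - 3 / 4 * x k))
    (hcond : ∀ k ∈ A, k ≠ m₀ →
      x k * (min (4 * (pred k : ℝ) * k / ((k : ℝ) + pred k) ^ 2 * μ (pred k))
          (2 * lam (pred k) * ((pred k : ℝ) / k) - (2 * ((pred k : ℝ) / k) - (1 - ((k : ℝ) / ((k : ℝ) + pred k)) ^ 2)) * (x (pred k) / (1 - 3 / 4 * x (pred k)))) + 3 / 4) < 1)
    (hrecμ : ∀ k ∈ A, k ≠ m₀ →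
      min (4 * (pred k : ℝ) * k / ((k : ℝ) + pred k) ^ 2 * μ (pred k))
          (2 * lam (pred k) * ((pred k : ℝ) / k) - (2 * ((pred k : ℝ) / k) - (1 - ((k : ℝ) / ((k : ℝ) + pred k)) ^ 2)) * (x (pred k) / (1 - 3 / 4 * x (pred k)))) * (1 + x k) + 3 / 4 * x k ≤
        μ k * (1 - x k * (3 / 4 + min (4 * (pred k : ℝ) * k / ((k : ℝ) + pred k) ^ 2 * μ (pred k))
          (2 * lam (pred k) * ((pred k : ℝ) / k) - (2 * ((pred k : ℝ) / k) - (1 - ((k : ℝ) / ((k : ℝ) + pred k)) ^ 2)) * (x (pred k) / (1 - 3 / 4 * x (pred k)))))))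
    (hrecL : ∀ k ∈ A, k ≠ m₀ →
      lam (pred k) * ((pred k : ℝ) / k) * (1 + x k / 4) +
          x k * (1 + min (4 * (pred k : ℝ) * k / ((k : ℝ) + pred k) ^ 2 * μ (pred k))
          (2 * lam (pred k) * ((pred k : ℝ) / k) - (2 * ((pred k : ℝ) / k) - (1 - ((k : ℝ) / ((k : ℝ) + pred k)) ^ 2)) * (x (pred k) / (1 - 3 / 4 * x (pred k))))) ≤
        lam k * (1 - x k * (3 / 4 + min (4 * (pred k : ℝ) * k / ((k : ℝ) + pred k) ^ 2 * μ (pred k))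
          (2 * lam (pred k) * ((pred k : ℝ) / k) - (2 * ((pred k : ℝ) / k) - (1 - ((k : ℝ) / ((k : ℝ) + pred k)) ^ 2)) * (x (pred k) / (1 - 3 / 4 * x (pred k))))))) :
    ∃ π : ℕ → ℝ, (∀ k ∈ A, 0 ≤ π k) ∧
      (∀ k' ∈ A, 1 ≤ π k' + ∑ j ∈ A, x j * ((k' : ℝ) / ((k' : ℝ) + j)) ^ 2 * π j) ∧ ∑ j ∈ A, x j * π j ≤ 1 := by
  classical
  have hx₀ : 3 / 4 * x m₀ < 1 := hx34 m₀ hm₀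
  have hlam₀ : x m₀ ≤ lam m₀ * (1 - 3 / 4 * x m₀) := hlamx m₀ hm₀
  have hdiag : ∀ k : ℕ, 1 ≤ k → ((k : ℝ) / ((k : ℝ) + k)) ^ 2 = 1 / 4 := by
    intro k hk
    have hkr : (0 : ℝ) < k := by exact_mod_cast hk
    rw [show (k : ℝ) / ((k : ℝ) + k) = 1 / 2 by field_simp; ring]
    norm_num
  -- the main claim over initial segments S of A, with the two potentials
  have key : ∀ S : Finset ℕ, S ⊆ A → (∀ k ∈ S, ∀ k'' ∈ A, k'' < k → k'' ∈ S) →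
      ∃ π : ℕ → ℝ, (∀ k ∈ S, 0 ≤ π k) ∧
        (∀ k' ∈ S, 1 ≤ π k' + ∑ j ∈ S, x j * ((k' : ℝ) / ((k' : ℝ) + j)) ^ 2 * π j) ∧
        0 ≤ 1 - ∑ j ∈ S, x j * π j ∧
        (∀ hS : S.Nonempty, ∑ j ∈ S, (1 - ((S.max' hS : ℝ) / ((S.max' hS : ℝ) + j)) ^ 2) * (x j * π j) ≤
          μ (S.max' hS) * (1 - ∑ j ∈ S, x j * π j)) ∧
        (∀ hS : S.Nonempty, ∑ j ∈ S, (j : ℝ) * (x j * π j) ≤ lam (S.max' hS) * (S.max' hS) * (1 - ∑ j ∈ S, x j * π j)) ∧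
        (∀ hS : S.Nonempty, x (S.max' hS) * (1 - ∑ j ∈ S, x j * π j) ≤ x (S.max' hS) * π (S.max' hS) * (1 - 3 / 4 * x (S.max' hS))) := by
    intro S
    induction S using Finset.induction_on_max with
    | empty =>
      intro _ _
      exact ⟨fun _ => 0, fun _ h => absurd h (notMem_empty _), fun _ h => absurd h (notMem_empty _), by simp,
        fun hS => absurd hS Finset.not_nonempty_empty, fun hS => absurd hS Finset.not_nonempty_empty,
        fun hS => absurd hS Finset.not_nonempty_empty⟩
    | insert M s hlt ih =>
      intro hsub hinit
      have hMs : M ∉ s := fun h => lt_irrefl _ (hlt M h)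
      have hMA : M ∈ A := hsub (mem_insert_self M s)
      have hM1 : 1 ≤ M := hA1 M hMA
      have hMr : (0 : ℝ) < M := by exact_mod_cast hM1
      have hsA : s ⊆ A := fun k hk => hsub (mem_insert_of_mem hk)
      have hsinit : ∀ k ∈ s, ∀ k'' ∈ A, k'' < k → k'' ∈ s := by
        intro k hk k'' hk'' hlt'
        have h1 := hinit k (mem_insert_of_mem hk) k'' hk'' hlt'
        rcases mem_insert.mp h1 with h2 | h2
        · exact absurd (h2 ▸ hlt' : M < k) (not_lt.mpr (hlt k hk).le)
        · exact h2
      obtain ⟨π, hπ0, hfeas, hD, hΨ, hΦ, hSix⟩ := ih hsA hsinit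
      have hxM := hx M hMA
      have hμM := hμ M hMA
      have hlamM := hlam M hMA
      have hx4 : 0 < 1 + x M / 4 := by linarith
      obtain ⟨D, hD_def⟩ : ∃ D : ℝ, D = 1 - ∑ j ∈ s, x j * π j := ⟨_, rfl⟩
      obtain ⟨E, hE_def⟩ : ∃ E : ℝ, E = ∑ j ∈ s, (1 - ((M : ℝ) / ((M : ℝ) + j)) ^ 2) * (x j * π j) := ⟨_, rfl⟩
      obtain ⟨Φ, hΦ_def⟩ : ∃ Φ : ℝ, Φ = ∑ j ∈ s, (j : ℝ) * (x j * π j) := ⟨_, rfl⟩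
      have hD0 : 0 ≤ D := by rw [hD_def]; exact hD
      have hN : ∑ j ∈ s, x j * ((M : ℝ) / ((M : ℝ) + j)) ^ 2 * π j = (1 - D) - E := by
        rw [hD_def, hE_def, sub_sub_cancel, ← sum_sub_distrib]
        exact sum_congr rfl fun j _ => by ring
      have hE0 : 0 ≤ E := by
        rw [hE_def]
        refine sum_nonneg fun j hj => ?_
        have hj0 : (0 : ℝ) ≤ j := Nat.cast_nonneg j
        have hG1 : ((M : ℝ) / ((M : ℝ) + j)) ^ 2 ≤ 1 := by
          rw [div_pow, div_le_one (by positivity)]; nlinarith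
        exact mul_nonneg (by linarith) (mul_nonneg (hx j (hsA hj)) (hπ0 j hj))
      -- the far-field bound E ≤ 2Φ/M
      have hEΦ : E ≤ 2 / M * Φ := by
        rw [hE_def, hΦ_def, mul_sum]
        refine sum_le_sum fun j hj => ?_
        have hxp : 0 ≤ x j * π j := mul_nonneg (hx j (hsA hj)) (hπ0 j hj)
        have hd := defect_le_two_mul_div (Nat.cast_nonneg j) hMr
        calc (1 - ((M : ℝ) / ((M : ℝ) + j)) ^ 2) * (x j * π j) ≤ 2 * (j : ℝ) / M * (x j * π j) := mul_le_mul_of_nonneg_right hd hxp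
          _ = 2 / M * ((j : ℝ) * (x j * π j)) := by ring
      obtain ⟨v, hv_def⟩ : ∃ v : ℝ, v = (D + E) / (1 + x M / 4) := ⟨_, rfl⟩
      have hv0 : 0 ≤ v := by rw [hv_def]; exact div_nonneg (by linarith) hx4.le
      have hvN : v * (1 + x M / 4) = D + E := by rw [hv_def]; field_simp
      have hcN : x M * v * (1 + x M / 4) = x M * (D + E) := by rw [mul_assoc, hvN]
      obtain ⟨π', hπ'_def⟩ : ∃ π' : ℕ → ℝ, π' = fun k => if k = M then v else π k := ⟨_, rfl⟩
      have hπ'M : π' M = v := by rw [hπ'_def]; simp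
      have hπ's : ∀ j ∈ s, π' j = π j := fun j hj => by
        have : j ≠ M := fun h => hMs (h ▸ hj)
        rw [hπ'_def]; simp [this]
      have hsum1 : ∑ j ∈ insert M s, x j * π' j = x M * v + ∑ j ∈ s, x j * π j := by
        rw [sum_insert hMs, hπ'M]
        congr 1; exact sum_congr rfl fun j hj => by rw [hπ's j hj]
      have hsumG : ∀ k' : ℕ, ∑ j ∈ insert M s, x j * ((k' : ℝ) / ((k' : ℝ) + j)) ^ 2 * π' j =
          x M * ((k' : ℝ) / ((k' : ℝ) + M)) ^ 2 * v + ∑ j ∈ s, x j * ((k' : ℝ) / ((k' : ℝ) + j)) ^ 2 * π j := by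
        intro k'
        rw [sum_insert hMs, hπ'M]
        congr 1; exact sum_congr rfl fun j hj => by rw [hπ's j hj]
      have hsumΨ : ∑ j ∈ insert M s, (1 - ((M : ℝ) / ((M : ℝ) + j)) ^ 2) * (x j * π' j) = 3 / 4 * (x M * v) + E := by
        rw [sum_insert hMs, hπ'M, hdiag _ hM1, hE_def]
        have hrest : ∑ j ∈ s, (1 - ((M : ℝ) / ((M : ℝ) + j)) ^ 2) * (x j * π' j) =
            ∑ j ∈ s, (1 - ((M : ℝ) / ((M : ℝ) + j)) ^ 2) * (x j * π j) := sum_congr rfl fun j hj => by rw [hπ's j hj]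
        rw [hrest]; ring
      have hsumΦ : ∑ j ∈ insert M s, (j : ℝ) * (x j * π' j) = (M : ℝ) * (x M * v) + Φ := by
        rw [sum_insert hMs, hπ'M, hΦ_def]
        congr 1; exact sum_congr rfl fun j hj => by rw [hπ's j hj]
      have hmax : ∀ hS : (insert M s).Nonempty, (insert M s).max' hS = M := fun hS => by
        apply le_antisymm
        · exact max'_le _ hS _ fun k hk => by
            rcases mem_insert.mp hk with hkM | hk
            · exact hkM.le
            · exact (hlt k hk).le
        · exact le_max' _ _ (mem_insert_self M s)
      have hI1 : ∀ k ∈ insert M s, 0 ≤ π' k := by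
        intro k hk
        rcases mem_insert.mp hk with hkM | hk
        · rw [hkM, hπ'M]; exact hv0
        · rw [hπ's k hk]; exact hπ0 k hk
      have hI2 : ∀ k' ∈ insert M s, 1 ≤ π' k' + ∑ j ∈ insert M s, x j * ((k' : ℝ) / ((k' : ℝ) + j)) ^ 2 * π' j := by
        intro k' hk'
        rw [hsumG]
        rcases mem_insert.mp hk' with hkM | hk'
        · rw [hkM, hπ'M, hdiag _ hM1, hN]
          have : x M * (1 / 4) * v = v * (1 + x M / 4) - v := by ring
          rw [this, hvN]; linarith
        · rw [hπ's k' hk']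
          have h1 := hfeas k' hk'
          have h2 : 0 ≤ x M * ((k' : ℝ) / ((k' : ℝ) + M)) ^ 2 * v := by positivity
          linarith
      -- what the two cases must supply: a defect factor e and a transported age potential Λ
      suffices hI345 : ∃ e Λ : ℝ, 0 ≤ e ∧ E ≤ e * D ∧ Φ ≤ Λ * M * D ∧ x M * (e + 3 / 4) < 1 ∧
          e * (1 + x M) + 3 / 4 * x M ≤ μ M * (1 - x M * (3 / 4 + e)) ∧
          Λ * (1 + x M / 4) + x M * (1 + e) ≤ lam M * (1 - x M * (3 / 4 + e)) by
        obtain ⟨e, Λ, he0, hEe, hΦΛ, hc, hrμ, hrL⟩ := hI345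
        have h0 : D + E ≤ D + e * D := by linarith [hEe]
        have h1 : x M * (D + E) ≤ x M * D * (1 + e) :=
          calc x M * (D + E) ≤ x M * (D + e * D) := mul_le_mul_of_nonneg_left h0 hxM
            _ = x M * D * (1 + e) := by ring
        have h2 : x M * (1 + e) ≤ 1 + x M / 4 := by
          have ee : x M * (1 + e) = x M * (e + 3 / 4) + x M / 4 := by ring
          rw [ee]; linarith [hc]
        have hcD : x M * v ≤ D := by
          have h3 : x M * D * (1 + e) ≤ D * (1 + x M / 4) :=
            calc x M * D * (1 + e) = D * (x M * (1 + e)) := by ring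
              _ ≤ D * (1 + x M / 4) := mul_le_mul_of_nonneg_left h2 hD0
          have h4 : x M * v * (1 + x M / 4) ≤ D * (1 + x M / 4) := by rw [hcN]; exact h1.trans h3
          exact le_of_mul_le_mul_right h4 hx4
        have hxE : x M * E ≤ x M * (e * D) := mul_le_mul_of_nonneg_left hEe hxM
        refine ⟨π', hI1, hI2, ?_, fun hS => ?_, fun hS => ?_, fun hS => ?_⟩
        · rw [hsum1, hD_def] at *; linarith [hcD]
        rotate_left 2
        · -- the sixth invariant: x_M (D − c) ≤ c (1 − 3x_M/4), i.e. D ≤ v (1 + x_M/4) = D + E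
          rw [hmax hS, hsum1, hπ'M, show 1 - (x M * v + ∑ j ∈ s, x j * π j) = D - x M * v by rw [hD_def]; ring]
          have h5 : D ≤ v * (1 + x M / 4) := by rw [hvN]; linarith
          nlinarith [mul_le_mul_of_nonneg_left h5 hxM]
        · -- Ψ' = (3/4) c + E ≤ μ_M (D − c)
          rw [hmax hS, hsumΨ, hsum1, show 1 - (x M * v + ∑ j ∈ s, x j * π j) = D - x M * v by rw [hD_def]; ring]
          have hkey : E * (1 + x M + μ M * x M) ≤ D * (μ M * (1 - 3 / 4 * x M) - 3 / 4 * x M) := by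
            have hr' : e * (1 + x M) + e * μ M * x M ≤ μ M * (1 - 3 / 4 * x M) - 3 / 4 * x M := by
              have ee : μ M * (1 - x M * (3 / 4 + e)) = μ M * (1 - 3 / 4 * x M) - e * μ M * x M := by ring
              rw [ee] at hrμ; linarith
            have h5 : E * (1 + x M + μ M * x M) ≤ e * D * (1 + x M + μ M * x M) :=
              mul_le_mul_of_nonneg_right hEe (by positivity)
            have h6 : e * D * (1 + x M + μ M * x M) = D * (e * (1 + x M) + e * μ M * x M) := by ring
            rw [h6] at h5
            exact h5.trans (mul_le_mul_of_nonneg_left hr' hD0)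
          have hgoal : (3 / 4 * (x M * v) + E) * (1 + x M / 4) ≤ (μ M * (D - x M * v)) * (1 + x M / 4) := by
            have e1 : (3 / 4 * (x M * v) + E) * (1 + x M / 4) = 3 / 4 * (x M * v * (1 + x M / 4)) + E * (1 + x M / 4) := by
              ring
            have e2 : (μ M * (D - x M * v)) * (1 + x M / 4) = μ M * (D * (1 + x M / 4) - x M * v * (1 + x M / 4)) := by
              ring
            rw [e1, e2, hcN]
            calc 3 / 4 * (x M * (D + E)) + E * (1 + x M / 4)
                = E * (1 + x M + μ M * x M) + (3 / 4 * x M * D - μ M * x M * E) := by ring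
              _ ≤ D * (μ M * (1 - 3 / 4 * x M) - 3 / 4 * x M) + (3 / 4 * x M * D - μ M * x M * E) :=
                  add_le_add hkey le_rfl
              _ = μ M * (D * (1 + x M / 4) - x M * (D + E)) := by ring
          exact le_of_mul_le_mul_right hgoal hx4
        · -- Φ' = M c + Φ ≤ λ_M M (D − c)
          rw [hmax hS, hsumΦ, hsum1, show 1 - (x M * v + ∑ j ∈ s, x j * π j) = D - x M * v by rw [hD_def]; ring]
          have hMD : 0 ≤ (M : ℝ) * D := by positivity
          have hgoal : ((M : ℝ) * (x M * v) + Φ) * (1 + x M / 4) ≤ (lam M * M * (D - x M * v)) * (1 + x M / 4) :=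
            calc ((M : ℝ) * (x M * v) + Φ) * (1 + x M / 4) = (M : ℝ) * (x M * v * (1 + x M / 4)) + Φ * (1 + x M / 4) := by ring
              _ = (M : ℝ) * (x M * (D + E)) + Φ * (1 + x M / 4) := by rw [hcN]
              _ ≤ (M : ℝ) * (x M * D * (1 + e)) + Λ * M * D * (1 + x M / 4) :=
                  add_le_add (mul_le_mul_of_nonneg_left h1 hMr.le) (mul_le_mul_of_nonneg_right hΦΛ hx4.le)
              _ = (M : ℝ) * D * (x M * (1 + e) + Λ * (1 + x M / 4)) := by ring
              _ ≤ (M : ℝ) * D * (lam M * (1 - x M * (3 / 4 + e))) := mul_le_mul_of_nonneg_left (by linarith [hrL]) hMD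
              _ = lam M * M * (D - 3 / 4 * x M * D) - lam M * M * (x M * (e * D)) := by ring
              _ ≤ lam M * M * (D - 3 / 4 * x M * D) - lam M * M * (x M * E) :=
                  sub_le_sub_left (mul_le_mul_of_nonneg_left hxE (by positivity)) _
              _ = lam M * M * (D * (1 + x M / 4) - x M * (D + E)) := by ring
              _ = lam M * M * (D * (1 + x M / 4) - x M * v * (1 + x M / 4)) := by rw [hcN]
              _ = (lam M * M * (D - x M * v)) * (1 + x M / 4) := by ring
          exact le_of_mul_le_mul_right hgoal hx4
      rcases s.eq_empty_or_nonempty with hs | hs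
      · -- base: s = ∅, M = m₀: e = 0, Λ = 0
        have hD1 : D = 1 := by rw [hD_def, hs, sum_empty, sub_zero]
        have hE1 : E = 0 := by rw [hE_def, hs, sum_empty]
        have hΦ1 : Φ = 0 := by rw [hΦ_def, hs, sum_empty]
        have hMm : M = m₀ := by
          by_contra hne
          have hlt' : m₀ < M := lt_of_le_of_ne (hmin M hMA) (Ne.symm hne)
          have h1 := hinit M (mem_insert_self M s) m₀ hm₀ hlt'
          rw [hs, mem_insert] at h1
          rcases h1 with h1 | h1
          · exact absurd h1 (ne_of_lt hlt')
          · simp at h1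
        refine ⟨0, 0, le_rfl, by rw [hE1, zero_mul], by rw [hΦ1, zero_mul, zero_mul], ?_, ?_, ?_⟩
        · rw [hMm]; linarith
        · rw [hMm]; linarith
        · rw [hMm]; linarith
      · -- step: s nonempty with maximum M' = pred M: e = min(a μ', 2 λ' r), Λ = λ' r
        obtain ⟨M', hM'_def⟩ : ∃ M' : ℕ, M' = s.max' hs := ⟨_, rfl⟩
        have hM's : M' ∈ s := hM'_def ▸ max'_mem s hs
        have hM'A : M' ∈ A := hsA hM's
        have hM'M : M' < M := hlt M' hM's
        have hne : M ≠ m₀ := fun h => by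
          have := hmin M' hM'A; rw [← h] at this; exact absurd hM'M (not_lt.mpr this)
        obtain ⟨hpA, hplt, hpmax⟩ := hpred M hMA hne
        have hpeq : pred M = M' := by
          apply le_antisymm
          · have h1 := hinit M (mem_insert_self M s) (pred M) hpA hplt
            rcases mem_insert.mp h1 with h2 | h2
            · exact absurd h2 (ne_of_lt hplt)
            · rw [hM'_def]; exact le_max' s _ h2
          · exact hpmax M' hM'A hM'M
        have hM'1 : 1 ≤ M' := hA1 M' hM'A
        have hM'r : (0 : ℝ) < M' := by exact_mod_cast hM'1
        obtain ⟨a, ha_def⟩ : ∃ a : ℝ, a = 4 * (M' : ℝ) * M / ((M : ℝ) + M') ^ 2 := ⟨_, rfl⟩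
        have ha0 : 0 ≤ a := by rw [ha_def]; positivity
        obtain ⟨r, hr_def⟩ : ∃ r : ℝ, r = (M' : ℝ) / M := ⟨_, rfl⟩
        have hr0 : 0 ≤ r := by rw [hr_def]; positivity
        obtain ⟨δ, hδ_def⟩ : ∃ δ : ℝ, δ = 1 - ((M : ℝ) / ((M : ℝ) + M')) ^ 2 := ⟨_, rfl⟩
        obtain ⟨σ', hσ_def⟩ : ∃ σ' : ℝ, σ' = x M' / (1 - 3 / 4 * x M') := ⟨_, rfl⟩
        have hc := hcond M hMA hne
        have hrμ := hrecμ M hMA hne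
        have hrL := hrecL M hMA hne
        rw [hpeq, ← ha_def, ← hr_def, ← hδ_def, ← hσ_def] at hc hrμ hrL
        have hx34' := hx34 M' hM'A
        have hxM' := hx M' hM'A
        have hσ0 : 0 ≤ σ' := by rw [hσ_def]; exact div_nonneg hxM' (by linarith)
        have hδ0 : 0 ≤ δ := by
          have hq : (M : ℝ) / ((M : ℝ) + M') ≤ 1 := by rw [div_le_one (by positivity)]; linarith
          have hq0 : 0 ≤ (M : ℝ) / ((M : ℝ) + M') := by positivity
          rw [hδ_def, sub_nonneg]; exact pow_le_one₀ hq0 hq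
        have hδr : δ ≤ 2 * r := by
          have hd := defect_le_two_mul_div (Nat.cast_nonneg M') hMr
          rw [hδ_def, hr_def, show 2 * ((M' : ℝ) / M) = 2 * (M' : ℝ) / M by ring]; exact hd
        have hlamσ : σ' ≤ lam M' := by
          rw [hσ_def, div_le_iff₀ (by linarith)]; exact hlamx M' hM'A
        have hΨ' := hΨ hs
        have hΦ' := hΦ hs
        rw [← hM'_def] at hΨ' hΦ'
        rw [← hΦ_def, ← hD_def] at hΦ'
        have hμM' := hμ M' hM'A
        have hlamM' := hlam M' hM'A
        -- E ≤ a μ' D (one-step transport, as in (E65c))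
        have hEΨ : E ≤ a * ∑ j ∈ s, (1 - ((M' : ℝ) / ((M' : ℝ) + j)) ^ 2) * (x j * π j) := by
          rw [hE_def, mul_sum]
          refine sum_le_sum fun j hj => ?_
          have hj1 : (1 : ℝ) ≤ j := by exact_mod_cast hA1 j (hsA hj)
          have hjM' : (j : ℝ) ≤ M' := by rw [hM'_def]; exact_mod_cast le_max' s j hj
          have hdr := defect_ratio_le (s := (j : ℝ)) (v := (M' : ℝ)) (w := (M : ℝ)) (by linarith) hjM' hM'r
            (by exact_mod_cast hM'M.le)
          have hxp : 0 ≤ x j * π j := mul_nonneg (hx j (hsA hj)) (hπ0 j hj)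
          calc (1 - ((M : ℝ) / ((M : ℝ) + j)) ^ 2) * (x j * π j)
              ≤ 4 * (M' : ℝ) * M / ((M : ℝ) + M') ^ 2 * (1 - ((M' : ℝ) / ((M' : ℝ) + j)) ^ 2) * (x j * π j) :=
                mul_le_mul_of_nonneg_right hdr hxp
            _ = a * ((1 - ((M' : ℝ) / ((M' : ℝ) + j)) ^ 2) * (x j * π j)) := by rw [ha_def]; ring
        have hEμ : E ≤ a * μ M' * D := by
          have h1 := mul_le_mul_of_nonneg_left hΨ' ha0
          rw [← hD_def] at h1
          calc E ≤ _ := hEΨ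
            _ ≤ a * (μ M' * D) := h1
            _ = a * μ M' * D := by ring
        -- E ≤ (2 λ' r − (2r − δ) σ') D: the nearest term exactly, the rest by the far field, the last consumption from below
        have hsplitE : E = δ * (x M' * π M') + ∑ j ∈ s.erase M', (1 - ((M : ℝ) / ((M : ℝ) + j)) ^ 2) * (x j * π j) := by
          rw [hE_def, ← Finset.add_sum_erase s _ hM's, hδ_def]
        have hsplitΦ : Φ = (M' : ℝ) * (x M' * π M') + ∑ j ∈ s.erase M', (j : ℝ) * (x j * π j) := by
          rw [hΦ_def, ← Finset.add_sum_erase s _ hM's]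
        have hrest : ∑ j ∈ s.erase M', (1 - ((M : ℝ) / ((M : ℝ) + j)) ^ 2) * (x j * π j) ≤ 2 / M * ∑ j ∈ s.erase M', (j : ℝ) * (x j * π j) := by
          rw [mul_sum]
          refine sum_le_sum fun j hj => ?_
          have hjs : j ∈ s := Finset.mem_of_mem_erase hj
          have hxp : 0 ≤ x j * π j := mul_nonneg (hx j (hsA hjs)) (hπ0 j hjs)
          have hd := defect_le_two_mul_div (Nat.cast_nonneg j) hMr
          calc (1 - ((M : ℝ) / ((M : ℝ) + j)) ^ 2) * (x j * π j) ≤ 2 * (j : ℝ) / M * (x j * π j) := mul_le_mul_of_nonneg_right hd hxp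
            _ = 2 / M * ((j : ℝ) * (x j * π j)) := by ring
        have hSix' := hSix hs
        rw [← hM'_def, ← hD_def] at hSix'
        have hclow : σ' * D ≤ x M' * π M' := by
          rw [hσ_def, div_mul_eq_mul_div, div_le_iff₀ (by linarith)]; linarith [hSix']
        have hEfar : E ≤ (2 * lam M' * r - (2 * r - δ) * σ') * D := by
          have h1 : E ≤ 2 / M * Φ - (2 * r - δ) * (x M' * π M') := by
            rw [hsplitE, hsplitΦ, hr_def]
            have : 2 / (M : ℝ) * ((M' : ℝ) * (x M' * π M')) = 2 * ((M' : ℝ) / M) * (x M' * π M') := by field_simp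
            rw [mul_add, this]; linarith [hrest]
          have h2 : 2 / M * Φ ≤ 2 * lam M' * r * D := by
            calc 2 / M * Φ ≤ 2 / M * (lam M' * M' * D) := mul_le_mul_of_nonneg_left hΦ' (by positivity)
              _ = 2 * lam M' * r * D := by rw [hr_def]; field_simp
          have h3 : (2 * r - δ) * (σ' * D) ≤ (2 * r - δ) * (x M' * π M') := mul_le_mul_of_nonneg_left hclow (by linarith)
          have e4 : (2 * lam M' * r - (2 * r - δ) * σ') * D = 2 * lam M' * r * D - (2 * r - δ) * (σ' * D) := by ring
          rw [e4]; linarith [h1, h2, h3]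
        have he0' : 0 ≤ 2 * lam M' * r - (2 * r - δ) * σ' := by
          nlinarith [mul_le_mul_of_nonneg_left hlamσ (by linarith : (0:ℝ) ≤ 2 * r), mul_nonneg hδ0 hσ0]
        refine ⟨min (a * μ M') (2 * lam M' * r - (2 * r - δ) * σ'), lam M' * r, le_min (mul_nonneg ha0 hμM') he0', ?_, ?_, hc, hrμ, hrL⟩
        · rw [min_mul_of_nonneg _ _ hD0]; exact le_min hEμ hEfar
        · calc Φ ≤ lam M' * M' * D := hΦ'
            _ = lam M' * r * M * D := by rw [hr_def]; field_simp
  obtain ⟨π, hπ0, hfeas, hD, _, _, _⟩ := key A Subset.rfl (fun _ _ k'' hk'' _ => hk'')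
  exact ⟨π, hπ0, hfeas, by linarith⟩

end Summit.QuantumFields.BalabanUV.Beta.EriceRemainderEnclosureHistoryAutonomyComparisonGreedyNearChain

end
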